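/-
Copyright: rh-split cell (dbn column, prover seat l19-w2) gen 2, 2026-08-27.  LINE 3 «two-ray Laguerre
squeeze» of ideator rh-idea-2 (D-0145): the PROVER-SIDE half of instrument spec «I-72k» §4 — from finitely
many certified sign / size data to the squeeze witness and to `¬Ray(a)`.  The linear-factor ray
`HasOnlyRealZeros (linearFactorH a)` is an RH-STRENGTHENING conjunct (`LinearRayTwoPoint.riemannHypothesis_of_linearRay`);
`¬Ray` statements are RH-free negative-side structure.  Nothing here bears on the truth of RH.
-/
import Summits.RiemannHypothesis.RiemannHypothesis.Theorems.Splittings.LinearRaySwing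
import HarnessLib

/-!
# Squeeze witness of data: consecutive simple zeros of `H_0` and a non-squeezed `F_a` from certificates

Objects (all existing declarations; this file declares no definitions): `H_0 = deBruijnH 0`,
`H_0^{(1)} = deBruijnH0Deriv 1`, the Laplace-smoothed factor `F_a = deBruijnHDiv (1 + u²/a²)`, its two one-sided
averages `P_a(x) = ∫₀^∞ H_0(x − y) e^{−ay} dy`, `Q_a(x) = ∫₀^∞ H_0(x + y) e^{−ay} dy`
(`UniversalFactor.deBruijnHDiv_laplace_eq_half_mul_add`: `F_a = (a/2)(P_a + Q_a)`), and the linear-factor ray member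
`linearFactorH a` of `Literature/Barriers/RiemannHypothesis/NewmanConjecture.lean`.

**Purpose.**  The squeeze-witness items of route `DBN` (the `∃ x₁ x₂ …` clause of `DBN.TypicalGapSqueezeSupply`,
stmt-RiemannHypothesis-22394, and the finite instrument target `DBN.TypicalGapSqueezeWitness25`,
stmt-RiemannHypothesis-22511) quantify over EXACT zeros `H_0(x_i) = 0`, which no instrument certifies directly.
This file is the analytic interface: EXACT zeros, their simplicity, `no zero in between` and the strict margin on
the closed gap all follow from finitely many inequalities an interval evaluator can certify on two brackets
`[p₁, q₁]`, `[p₂, q₂]` and their hull `[p₁, q₂]` (intermediate value theorem + strict monotonicity).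

**Content.**
* `exists_zero_of_bracket` (abstract, `h : ℝ → ℝ` with `HasDerivAt h (h' x) x`): `h p < 0 < h q` and `h' > 0` on
  `[p, q]` give a zero `x ∈ (p, q)` with `h' x ≠ 0`, `h < 0` on `[p, x)` and `h > 0` on `(x, q]`.
* `exists_consecutive_simple_zeros_of_data` (**configuration certificate**, orientation `σ = ±1`):
  `σ·Re H_0(p₁) < 0`, `σ·Re H_0(q₂) < 0`, `σ·Re H_0 > 0` on `[q₁, p₂]`, `σ·Re H_0^{(1)} > 0` on `[p₁, q₁]`,
  `σ·Re H_0^{(1)} < 0` on `[p₂, q₂]` (`p₁ < q₁ ≤ p₂ < q₂`) give consecutive SIMPLE real zeros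
  `x₁ ∈ (p₁, q₁)`, `x₂ ∈ (p₂, q₂)` of `H_0` with no zero of `H_0` strictly between them.
* `squeezeWitness_of_data` (**squeeze witness of data**, any `a ≥ 0`): the configuration certificate plus
  `a (q₂ − p₁) ≤ 1` and the hull margin `a (q₂ − p₁) |Re H_0(y)| < |Re F_a(y)|` on `[p₁, q₂]` give the full
  `∃ x₁ x₂ …` clause of the two items (with `p₁ < x₁`, `x₂ < q₂`).
* `not_hasOnlyRealZeros_linearFactorH_of_squeezeData` (**squeeze certificate against the ray**, any `a > 0`,
  RH-free): the same data refute `HasOnlyRealZeros (linearFactorH a)`, by the swing lemma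
  `LinearRaySwing.linearRaySwingLemma` (stmt-RiemannHypothesis-22393, proved) — a third finite certificate format
  on the ray beside the two-point (`LinearRayTwoPoint`) and dip (`LinearRayDipCertificate`) certificates, of
  reach `a · (x-gap) ≤ 1` per close pair (B20 family, `LinearRayFiniteReach`).
* scale-free plumbing for an engine run in a common unit `κ > 0` (all sizes at height `x ≈ 1.4·10⁵` are
  astronomically small, cf. `UniversalFactor.lehmerK0`): `hullMargin_of_scaled_bounds`
  (`|Re H_0| ≤ κM`, `κm ≤ |Re F_a|`, `a(q₂ − p₁)·M < m`), `re_laplaceFactor_eq_half_mul_add`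
  (`Re F_a = (a/2)(Re P_a + Re Q_a)` on `ℝ`) and `le_abs_re_laplaceFactor_of_oneSided` (same-sign lower bounds
  `κp ≤ τ·Re P_a(x)`, `κq ≤ τ·Re Q_a(x)` give `κ·(a/2)(p + q) ≤ |Re F_a(x)|`) — the one-sided averages and their
  tails for general rate `a ≥ 1` and general height `t₀ ≥ 7000` are the engine's existing primitives
  (`UniversalFactor.stub_highTailQ`, `UniversalFactor.stub_highTailP`).

No `sorry`, no new axioms, no instances, no notation, no definitions.  RH is not proved by any of this; nothing
here bears on the truth of RH.
-/

set_option linter.dupNamespace false  -- the mandated namespace repeats `RiemannHypothesis`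

namespace Summit.RiemannHypothesis.RiemannHypothesis.Theorems.Splittings.LinearRaySqueezeWitness

open Complex Filter Topology Set MeasureTheory
open Literature.NumberTheory.LFunctions Literature.Analysis.Complex
open Literature.Barriers.RiemannHypothesis (linearFactorH)
open Summit.RiemannHypothesis.RiemannHypothesis.Theorems
open Summit.RiemannHypothesis.RiemannHypothesis.Theorems.Splittings.LinearRayZeroSigns
open Summit.RiemannHypothesis.RiemannHypothesis.Theorems.Splittings.LinearRaySwing

/-! ## An abstract bracket: one simple zero from a sign change with a signed derivative -/

/-- **Bracketed simple zero** (intermediate value theorem + strict monotonicity).  If `h` has derivative `h'`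
everywhere, `h p < 0 < h q` and `h' > 0` on `[p, q]`, then `h` has a zero `x ∈ (p, q)` with `h' x ≠ 0`, and
`h < 0` on `[p, q] ∩ {y < x}`, `h > 0` on `[p, q] ∩ {x < y}`. [folklore] -/
theorem exists_zero_of_bracket {h h' : ℝ → ℝ} (hd : ∀ x, HasDerivAt h (h' x) x) {p q : ℝ} (hpq : p < q)
    (hp : h p < 0) (hq : 0 < h q) (hpos : ∀ y ∈ Icc p q, 0 < h' y) :
    ∃ x ∈ Ioo p q, h x = 0 ∧ h' x ≠ 0 ∧ (∀ y ∈ Icc p q, y < x → h y < 0) ∧ (∀ y ∈ Icc p q, x < y → 0 < h y) := by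
  have hcont : Continuous h := continuous_iff_continuousAt.2 fun x ↦ (hd x).continuousAt
  have hivt : Ioo (h p) (h q) ⊆ h '' Ioo p q := intermediate_value_Ioo hpq.le hcont.continuousOn
  obtain ⟨x, hx, hx0⟩ := hivt ⟨hp, hq⟩
  have hmono : StrictMonoOn h (Icc p q) :=
    strictMonoOn_of_deriv_pos (convex_Icc p q) hcont.continuousOn fun y hy ↦ by
      rw [(hd y).deriv]
      exact hpos y (interior_subset hy)
  have hxI : x ∈ Icc p q := Ioo_subset_Icc_self hx
  refine ⟨x, hx, hx0, (hpos x hxI).ne', fun y hy hyx ↦ ?_, fun y hy hxy ↦ ?_⟩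
  · have := hmono hy hxI hyx
    rwa [hx0] at this
  · have := hmono hxI hy hxy
    rwa [hx0] at this

/-! ## Real-axis bookkeeping for `H_0` and `H_0^{(1)}` -/

/-- A real point is a zero of `H_0` as soon as the real part vanishes (`H_0` is real on `ℝ`). [folklore] -/
theorem deBruijnH_zero_ofReal_eq_zero_of_re {x : ℝ} (hx : (deBruijnH 0 (x : ℂ)).re = 0) :
    deBruijnH 0 (x : ℂ) = 0 :=
  Complex.ext (by simpa using hx) (by simpa using UniversalFactor.deBruijnH_zero_ofReal_im x)

/-- A real point where the real part of `H_0` is non-zero is not a zero of `H_0`. [folklore] -/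
theorem deBruijnH_zero_ofReal_ne_zero_of_re {x : ℝ} (hx : (deBruijnH 0 (x : ℂ)).re ≠ 0) :
    deBruijnH 0 (x : ℂ) ≠ 0 := fun h ↦ hx (by rw [h, Complex.zero_re])

/-- A real point where the real part of `H_0^{(1)}` is non-zero is not a zero of `H_0^{(1)}`. [folklore] -/
theorem deBruijnH0Deriv_one_ofReal_ne_zero_of_re {x : ℝ} (hx : (deBruijnH0Deriv 1 (x : ℂ)).re ≠ 0) :
    deBruijnH0Deriv 1 (x : ℂ) ≠ 0 := fun h ↦ hx (by rw [h, Complex.zero_re])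

/-- The oriented real function `t ↦ σ·Re H_0(t)` has derivative `σ·Re H_0^{(1)}(t)`. [folklore] -/
theorem hasDerivAt_sigma_mul_re_deBruijnH_zero (σ x : ℝ) :
    HasDerivAt (fun t : ℝ ↦ σ * (deBruijnH 0 (t : ℂ)).re) (σ * (deBruijnH0Deriv 1 (x : ℂ)).re) x :=
  (hasDerivAt_re_deBruijnH_zero x).const_mul σ

/-! ## The configuration certificate: two consecutive simple zeros from bracket data -/

/-- **Configuration certificate.**  Orientation `σ = ±1`, brackets `p₁ < q₁ ≤ p₂ < q₂`.  If
`σ·Re H_0(p₁) < 0`, `σ·Re H_0(q₂) < 0`, `σ·Re H_0 > 0` on `[q₁, p₂]`, `σ·Re H_0^{(1)} > 0` on `[p₁, q₁]` and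
`σ·Re H_0^{(1)} < 0` on `[p₂, q₂]`, then there are SIMPLE real zeros `x₁ ∈ (p₁, q₁)`, `x₂ ∈ (p₂, q₂)` of `H_0`
(`H_0(x_i) = 0`, `H_0^{(1)}(x_i) ≠ 0`) with no zero of `H_0` strictly between them — the exact-zero clauses of
`DBN.TypicalGapSqueezeSupply` / `DBN.TypicalGapSqueezeWitness25` from finitely many certifiable inequalities.
RH-free real analysis; nothing here bears on the truth of RH. -/
theorem exists_consecutive_simple_zeros_of_data {σ p₁ q₁ p₂ q₂ : ℝ} (hσ : σ = 1 ∨ σ = -1)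
    (h₁ : p₁ < q₁) (h₁₂ : q₁ ≤ p₂) (h₂ : p₂ < q₂)
    (hp₁ : σ * (deBruijnH 0 ((p₁ : ℝ) : ℂ)).re < 0) (hq₂ : σ * (deBruijnH 0 ((q₂ : ℝ) : ℂ)).re < 0)
    (hmid : ∀ y ∈ Icc q₁ p₂, 0 < σ * (deBruijnH 0 ((y : ℝ) : ℂ)).re)
    (hup : ∀ y ∈ Icc p₁ q₁, 0 < σ * (deBruijnH0Deriv 1 ((y : ℝ) : ℂ)).re)
    (hdown : ∀ y ∈ Icc p₂ q₂, σ * (deBruijnH0Deriv 1 ((y : ℝ) : ℂ)).re < 0) :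
    ∃ x₁ ∈ Ioo p₁ q₁, ∃ x₂ ∈ Ioo p₂ q₂,
      deBruijnH 0 ((x₁ : ℝ) : ℂ) = 0 ∧ deBruijnH 0 ((x₂ : ℝ) : ℂ) = 0 ∧
      deBruijnH0Deriv 1 ((x₁ : ℝ) : ℂ) ≠ 0 ∧ deBruijnH0Deriv 1 ((x₂ : ℝ) : ℂ) ≠ 0 ∧
      ∀ z ∈ Ioo x₁ x₂, deBruijnH 0 ((z : ℝ) : ℂ) ≠ 0 := by
  have hσ0 : σ ≠ 0 := by rcases hσ with rfl | rfl <;> norm_num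
  -- oriented function and its derivative
  set g : ℝ → ℝ := fun t ↦ σ * (deBruijnH 0 (t : ℂ)).re with hg
  set g' : ℝ → ℝ := fun t ↦ σ * (deBruijnH0Deriv 1 (t : ℂ)).re with hg'
  have hd : ∀ x, HasDerivAt g (g' x) x := fun x ↦ hasDerivAt_sigma_mul_re_deBruijnH_zero σ x
  have hdn : ∀ x, HasDerivAt (fun t ↦ -g t) (-g' x) x := fun x ↦ (hd x).neg
  -- first bracket: `g` crosses upwards
  have hq₁ : 0 < g q₁ := hmid q₁ ⟨le_rfl, h₁₂⟩
  obtain ⟨x₁, hx₁, hx₁0, hx₁', -, hx₁pos⟩ := exists_zero_of_bracket hd h₁ hp₁ hq₁ hup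
  -- second bracket: `-g` crosses upwards
  have hp₂ : 0 < g p₂ := hmid p₂ ⟨h₁₂, le_rfl⟩
  obtain ⟨x₂, hx₂, hx₂0, hx₂', hx₂neg, -⟩ := exists_zero_of_bracket hdn h₂ (by simpa using hp₂)
    (by simpa using hq₂) (fun y hy ↦ by simpa using hdown y hy)
  -- read back through `σ`
  have hz₁ : (deBruijnH 0 (x₁ : ℂ)).re = 0 := by
    rcases mul_eq_zero.1 hx₁0 with h | h
    · exact absurd h hσ0
    · exact h
  have hz₂ : (deBruijnH 0 (x₂ : ℂ)).re = 0 := by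
    have : g x₂ = 0 := by simpa using hx₂0
    rcases mul_eq_zero.1 this with h | h
    · exact absurd h hσ0
    · exact h
  have hd₁ : (deBruijnH0Deriv 1 (x₁ : ℂ)).re ≠ 0 := fun h ↦ hx₁' (by simp [hg', h])
  have hd₂ : (deBruijnH0Deriv 1 (x₂ : ℂ)).re ≠ 0 := fun h ↦ hx₂' (by simp [hg', h])
  refine ⟨x₁, hx₁, x₂, hx₂, deBruijnH_zero_ofReal_eq_zero_of_re hz₁, deBruijnH_zero_ofReal_eq_zero_of_re hz₂,
    deBruijnH0Deriv_one_ofReal_ne_zero_of_re hd₁, deBruijnH0Deriv_one_ofReal_ne_zero_of_re hd₂, fun z hz ↦ ?_⟩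
  -- no zero strictly between: `g > 0` on `(x₁, x₂)`
  have hgz : 0 < g z := by
    rcases le_or_gt z q₁ with hzq | hzq
    · exact hx₁pos z ⟨(hx₁.1.trans hz.1).le, hzq⟩ hz.1
    · rcases le_or_gt z p₂ with hzp | hzp
      · exact hmid z ⟨hzq.le, hzp⟩
      · have := hx₂neg z ⟨hzp.le, (hz.2.trans hx₂.2).le⟩ hz.2
        simpa using this
  exact deBruijnH_zero_ofReal_ne_zero_of_re fun h ↦ by simp [hg, h] at hgz

/-! ## The squeeze witness of data -/

/-- **Squeeze witness of data** (`a ≥ 0`; the `∃ x₁ x₂ …` clause of `DBN.TypicalGapSqueezeSupply` /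
`DBN.TypicalGapSqueezeWitness25` from certificates).  The configuration certificate of
`exists_consecutive_simple_zeros_of_data`, the reach condition `a (q₂ − p₁) ≤ 1` and the HULL MARGIN
`a (q₂ − p₁) |Re H_0(y)| < |Re F_a(y)|` for all `y ∈ [p₁, q₂]` (`F_a = deBruijnHDiv (1 + u²/a²)`) give consecutive
simple real zeros `p₁ < x₁ < x₂ < q₂` of `H_0` with `a (x₂ − x₁) ≤ 1` on whose closed gap `F_a` is nowhere squeezed:
`a (x₂ − x₁) |Re H_0(y)| < |Re F_a(y)|` on `[x₁, x₂]`.  RH-free; nothing here bears on the truth of RH. -/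
theorem squeezeWitness_of_data {a σ p₁ q₁ p₂ q₂ : ℝ} (ha : 0 ≤ a) (hσ : σ = 1 ∨ σ = -1)
    (h₁ : p₁ < q₁) (h₁₂ : q₁ ≤ p₂) (h₂ : p₂ < q₂) (hreach : a * (q₂ - p₁) ≤ 1)
    (hp₁ : σ * (deBruijnH 0 ((p₁ : ℝ) : ℂ)).re < 0) (hq₂ : σ * (deBruijnH 0 ((q₂ : ℝ) : ℂ)).re < 0)
    (hmid : ∀ y ∈ Icc q₁ p₂, 0 < σ * (deBruijnH 0 ((y : ℝ) : ℂ)).re)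
    (hup : ∀ y ∈ Icc p₁ q₁, 0 < σ * (deBruijnH0Deriv 1 ((y : ℝ) : ℂ)).re)
    (hdown : ∀ y ∈ Icc p₂ q₂, σ * (deBruijnH0Deriv 1 ((y : ℝ) : ℂ)).re < 0)
    (hmargin : ∀ y ∈ Icc p₁ q₂, a * (q₂ - p₁) * |(deBruijnH 0 ((y : ℝ) : ℂ)).re|
      < |(deBruijnHDiv (fun u : ℝ => 1 + u ^ 2 / a ^ 2) ((y : ℝ) : ℂ)).re|) :
    ∃ x₁ x₂ : ℝ, p₁ < x₁ ∧ x₂ < q₂ ∧ x₁ < x₂ ∧ a * (x₂ - x₁) ≤ 1 ∧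
      deBruijnH 0 ((x₁ : ℝ) : ℂ) = 0 ∧ deBruijnH 0 ((x₂ : ℝ) : ℂ) = 0 ∧
      deBruijnH0Deriv 1 ((x₁ : ℝ) : ℂ) ≠ 0 ∧ deBruijnH0Deriv 1 ((x₂ : ℝ) : ℂ) ≠ 0 ∧
      (∀ z ∈ Ioo x₁ x₂, deBruijnH 0 ((z : ℝ) : ℂ) ≠ 0) ∧
      ∀ y ∈ Icc x₁ x₂, a * (x₂ - x₁) * |(deBruijnH 0 ((y : ℝ) : ℂ)).re|
        < |(deBruijnHDiv (fun u : ℝ => 1 + u ^ 2 / a ^ 2) ((y : ℝ) : ℂ)).re| := by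
  obtain ⟨x₁, hx₁, x₂, hx₂, hz₁, hz₂, hd₁, hd₂, hgap⟩ :=
    exists_consecutive_simple_zeros_of_data hσ h₁ h₁₂ h₂ hp₁ hq₂ hmid hup hdown
  have hx : x₁ < x₂ := lt_of_lt_of_le hx₁.2 (h₁₂.trans hx₂.1.le)
  have hδ : x₂ - x₁ ≤ q₂ - p₁ := by linarith [hx₁.1, hx₂.2]
  refine ⟨x₁, x₂, hx₁.1, hx₂.2, hx, (mul_le_mul_of_nonneg_left hδ ha).trans hreach, hz₁, hz₂, hd₁, hd₂, hgap,
    fun y hy ↦ ?_⟩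
  have hyI : y ∈ Icc p₁ q₂ := ⟨hx₁.1.le.trans hy.1, hy.2.trans hx₂.2.le⟩
  exact lt_of_le_of_lt (mul_le_mul_of_nonneg_right (mul_le_mul_of_nonneg_left hδ ha) (abs_nonneg _))
    (hmargin y hyI)

/-! ## The squeeze certificate against the ray -/

/-- **Squeeze certificate against the linear-factor ray** (any `a > 0`, RH-free).  The data of
`squeezeWitness_of_data` refute `HasOnlyRealZeros (linearFactorH a)`: on the certified pair of consecutive simple
zeros the swing lemma (`LinearRaySwing.linearRaySwingLemma`, GIVEN the ray) produces a point of the closed gap where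
`|Re F_a| ≤ a (x₂ − x₁) |Re H_0|`, against the margin.  Reach `a · (q₂ − p₁) ≤ 1` per close pair (B20 family).
Negative-side bookkeeping on an RH-STRENGTHENING ray; nothing here bears on the truth of RH. -/
theorem not_hasOnlyRealZeros_linearFactorH_of_squeezeData {a σ p₁ q₁ p₂ q₂ : ℝ} (ha : 0 < a)
    (hσ : σ = 1 ∨ σ = -1) (h₁ : p₁ < q₁) (h₁₂ : q₁ ≤ p₂) (h₂ : p₂ < q₂) (hreach : a * (q₂ - p₁) ≤ 1)
    (hp₁ : σ * (deBruijnH 0 ((p₁ : ℝ) : ℂ)).re < 0) (hq₂ : σ * (deBruijnH 0 ((q₂ : ℝ) : ℂ)).re < 0)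
    (hmid : ∀ y ∈ Icc q₁ p₂, 0 < σ * (deBruijnH 0 ((y : ℝ) : ℂ)).re)
    (hup : ∀ y ∈ Icc p₁ q₁, 0 < σ * (deBruijnH0Deriv 1 ((y : ℝ) : ℂ)).re)
    (hdown : ∀ y ∈ Icc p₂ q₂, σ * (deBruijnH0Deriv 1 ((y : ℝ) : ℂ)).re < 0)
    (hmargin : ∀ y ∈ Icc p₁ q₂, a * (q₂ - p₁) * |(deBruijnH 0 ((y : ℝ) : ℂ)).re|
      < |(deBruijnHDiv (fun u : ℝ => 1 + u ^ 2 / a ^ 2) ((y : ℝ) : ℂ)).re|) :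
    ¬ HasOnlyRealZeros (linearFactorH a) := by
  intro hRay
  obtain ⟨x₁, x₂, -, -, hx, haδ, hz₁, hz₂, hd₁, hd₂, hgap, hbig⟩ :=
    squeezeWitness_of_data ha.le hσ h₁ h₁₂ h₂ hreach hp₁ hq₂ hmid hup hdown hmargin
  obtain ⟨y, hy, hle⟩ := linearRaySwingLemma ha hRay hx haδ hz₁ hz₂ hd₁ hd₂ hgap
  exact absurd (hbig y hy) (not_lt.2 hle)

/-! ## Scale-free plumbing for an engine run -/

/-- **Hull margin from scaled bounds.**  In a common unit `κ > 0`: if `|Re H_0| ≤ κ M` and `κ m ≤ |Re F_a|` on a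
set `S` and `L · M < m` with `L ≥ 0`, then `L |Re H_0(y)| < |Re F_a(y)|` on `S` (take `L = a (q₂ − p₁)`,
`S = [p₁, q₂]` for `squeezeWitness_of_data`). [folklore] -/
theorem hullMargin_of_scaled_bounds {a κ M m L : ℝ} {S : Set ℝ} (hκ : 0 < κ) (hL : 0 ≤ L) (hLM : L * M < m)
    (hH : ∀ y ∈ S, |(deBruijnH 0 ((y : ℝ) : ℂ)).re| ≤ κ * M)
    (hF : ∀ y ∈ S, κ * m ≤ |(deBruijnHDiv (fun u : ℝ => 1 + u ^ 2 / a ^ 2) ((y : ℝ) : ℂ)).re|) :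
    ∀ y ∈ S, L * |(deBruijnH 0 ((y : ℝ) : ℂ)).re| < |(deBruijnHDiv (fun u : ℝ => 1 + u ^ 2 / a ^ 2) ((y : ℝ) : ℂ)).re| := by
  intro y hy
  have h1 : L * |(deBruijnH 0 ((y : ℝ) : ℂ)).re| ≤ L * (κ * M) := mul_le_mul_of_nonneg_left (hH y hy) hL
  have h2 : L * (κ * M) < κ * m := by nlinarith
  exact lt_of_lt_of_le (lt_of_le_of_lt h1 h2) (hF y hy)

/-- **`Re F_a` is the mean of the two one-sided averages** on the real axis (`a > 0`):
`Re F_a(x) = (a/2) · (Re P_a(x) + Re Q_a(x))`, `P_a(x) = ∫₀^∞ H_0(x − y) e^{−ay} dy`,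
`Q_a(x) = ∫₀^∞ H_0(x + y) e^{−ay} dy` (real part of `UniversalFactor.deBruijnHDiv_laplace_eq_half_mul_add`). [folklore] -/
theorem re_laplaceFactor_eq_half_mul_add {a : ℝ} (ha : 0 < a) (x : ℝ) :
    (deBruijnHDiv (fun u : ℝ => 1 + u ^ 2 / a ^ 2) (x : ℂ)).re
      = a / 2 * ((∫ y in Ioi (0:ℝ), deBruijnH 0 ((x : ℂ) - y) * (Real.exp (-(a * y)) : ℂ)).re
          + (∫ y in Ioi (0:ℝ), deBruijnH 0 ((x : ℂ) + y) * (Real.exp (-(a * y)) : ℂ)).re) := by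
  rw [UniversalFactor.deBruijnHDiv_laplace_eq_half_mul_add ha x,
    show ((a : ℂ) / 2) = ((a / 2 : ℝ) : ℂ) by push_cast; ring, Complex.re_ofReal_mul, Complex.add_re]

/-- **Lower bound for `|Re F_a(x)|` from same-sign one-sided averages.**  In a unit `κ`, orientation `τ = ±1`:
`κ p ≤ τ·Re P_a(x)` and `κ q ≤ τ·Re Q_a(x)` give `κ · ((a/2)(p + q)) ≤ |Re F_a(x)|` (`a > 0`). [folklore] -/
theorem le_abs_re_laplaceFactor_of_oneSided {a κ p q τ : ℝ} (ha : 0 < a) (hτ : τ = 1 ∨ τ = -1) {x : ℝ}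
    (hP : κ * p ≤ τ * (∫ y in Ioi (0:ℝ), deBruijnH 0 ((x : ℂ) - y) * (Real.exp (-(a * y)) : ℂ)).re)
    (hQ : κ * q ≤ τ * (∫ y in Ioi (0:ℝ), deBruijnH 0 ((x : ℂ) + y) * (Real.exp (-(a * y)) : ℂ)).re) :
    κ * (a / 2 * (p + q)) ≤ |(deBruijnHDiv (fun u : ℝ => 1 + u ^ 2 / a ^ 2) (x : ℂ)).re| := by
  have hτabs : ∀ r : ℝ, τ * r ≤ |r| := fun r ↦ by
    rcases hτ with rfl | rfl
    · simpa using le_abs_self r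
    · simpa using neg_le_abs r
  refine le_trans ?_ (hτabs _)
  rw [re_laplaceFactor_eq_half_mul_add ha x]
  have ha2 : 0 < a / 2 := by positivity
  nlinarith

end Summit.RiemannHypothesis.RiemannHypothesis.Theorems.Splittings.LinearRaySqueezeWitness
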